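import Literature.Probability.LatticeModels.LatticeLaplacian
import HarnessLib

/-!
# Weighted nearest-neighbour Laplacians on `ℤ²` and their maximum principle

Topic `Literature/Probability/LatticeModels`. `LatticeLaplacian.lean` treats the plain
nearest-neighbour Laplacian `Δ H (v) = ∑_{k<4} (H(v + e_k) - H(v))`. The comparison of the
discrete primitive `H` of the FK-Ising observable with harmonic measures in
Duminil-Copin–Hongler–Nolin's Russo–Seymour–Welsh argument (arXiv:0912.4253, §3.1,
Proposition 8) uses instead a *modified* Laplacian at the sites next to the free arc,
eq. (modified_laplacian) there:
`Δ_• H(B) = (2+√2)/(6+5√2) [H(B_W)+H(B_N)+H(B_E)] + (2√2)/(6+5√2) H(B_S) - H(B) ≥ 0`,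
the generator of a nearest-neighbour random walk with *site-dependent positive jump rates*. This
file provides the corresponding operators
`Δ_c H (v) = ∑_{k<4} c(v, k) (H(v + e_k) - H(v))` for arbitrary positive weights
`c : ℤ² → Fin 4 → ℝ` and their maximum / minimum / comparison principles on finite sets, by the
argument of `LatticeLaplacian.lean` (a maximiser inside propagates eastwards by the mean value
inequality until it leaves the finite set). Everything is proved; [folklore].

* `weightedLaplacian c H v`, linearity, `weightedLaplacian_one` (constant weights `1` give the
  plain Laplacian);
* `IsWeightedSubharmonicOn / IsWeightedSuperharmonicOn c H S`;
* `IsWeightedSubharmonicOn.le_of_forall_boundary_le` (**maximum principle**, positive weights on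
  `S`), `IsWeightedSuperharmonicOn.ge_of_forall_boundary_ge` (minimum principle),
  `weighted_le_of_sub_super_of_boundary` (**comparison principle**: sub ≤ super given the
  inequality on the outer boundary) — the form in which DCHN's Proposition 8 compares `H` with the
  harmonic measures `H̃_•`, `H̃_∘` ("it is sufficient to show that `H_•` is subharmonic for the
  Laplacian that is the generator of `X_•`, since it has the same boundary values").

## References

* H. Duminil-Copin, C. Hongler, P. Nolin, *Connection probabilities and RSW-type bounds for the
  two-dimensional FK Ising model*, Comm. Pure Appl. Math. 64 (2011) 1165–1198, §3.1,
  Proposition 8 and eq. (modified_laplacian) — bib key `DuminilCopinHonglerNolin2011`.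
* G. Lawler, V. Limic, *Random Walk: A Modern Introduction* (2010), §6.1 (maximum principle).
-/

noncomputable section

namespace Literature.Probability.LatticeModels

open Finset

/-! ### The weighted Laplacian -/

/-- The **weighted nearest-neighbour Laplacian** on `ℤ²` with site-dependent weights
`c : ℤ² → Fin 4 → ℝ`: `Δ_c H (v) = ∑_{k<4} c(v,k) (H(v + e_k) - H(v))` — the generator of the
nearest-neighbour walk jumping from `v` to `v + e_k` at rate `c(v,k)` (DCHN 2011, §3.1, the walks
`X_•`, `X_∘` with rate `ρ` onto the extra layers). [cite: DuminilCopinHonglerNolin2011, §3.1] -/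
def weightedLaplacian (c : Site 2 → Fin 4 → ℝ) (H : Site 2 → ℝ) (v : Site 2) : ℝ :=
  ∑ k : Fin 4, c v k * (H (v + cornerUnit k) - H v)

variable {c : Site 2 → Fin 4 → ℝ}

/-- Constant weights `1` give the plain lattice Laplacian. [folklore] -/
theorem weightedLaplacian_one (H : Site 2 → ℝ) (v : Site 2) :
    weightedLaplacian (fun _ _ => 1) H v = latticeLaplacian H v := by
  simp [weightedLaplacian, latticeLaplacian]

/-- `Δ_c H (v) = (∑_k c(v,k) H(v + e_k)) - (∑_k c(v,k)) H(v)`. [folklore] -/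
theorem weightedLaplacian_eq (c : Site 2 → Fin 4 → ℝ) (H : Site 2 → ℝ) (v : Site 2) :
    weightedLaplacian c H v = (∑ k : Fin 4, c v k * H (v + cornerUnit k)) - (∑ k : Fin 4, c v k) * H v := by
  rw [weightedLaplacian, Finset.sum_mul, ← Finset.sum_sub_distrib]
  refine Finset.sum_congr rfl fun k _ => ?_
  ring

/-- For stochastic weights (`∑_k c(v,k) = 1`) the Laplacian is the mean value minus the value:
`Δ_c H (v) ≥ 0` is the sub-mean-value inequality. [folklore] -/
theorem weightedLaplacian_eq_of_sum_eq_one (H : Site 2 → ℝ) {v : Site 2} (hv : ∑ k : Fin 4, c v k = 1) :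
    weightedLaplacian c H v = (∑ k : Fin 4, c v k * H (v + cornerUnit k)) - H v := by
  rw [weightedLaplacian_eq, hv, one_mul]

/-- The weighted Laplacian is additive. [folklore] -/
theorem weightedLaplacian_add (H₁ H₂ : Site 2 → ℝ) (v : Site 2) :
    weightedLaplacian c (H₁ + H₂) v = weightedLaplacian c H₁ v + weightedLaplacian c H₂ v := by
  simp only [weightedLaplacian, Pi.add_apply, ← Finset.sum_add_distrib]
  refine Finset.sum_congr rfl fun k _ => ?_
  ring

/-- The weighted Laplacian commutes with negation. [folklore] -/
theorem weightedLaplacian_neg (H : Site 2 → ℝ) (v : Site 2) :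
    weightedLaplacian c (-H) v = -weightedLaplacian c H v := by
  simp only [weightedLaplacian, Pi.neg_apply, ← Finset.sum_neg_distrib]
  refine Finset.sum_congr rfl fun k _ => ?_
  ring

/-- The weighted Laplacian of a difference. [folklore] -/
theorem weightedLaplacian_sub (H₁ H₂ : Site 2 → ℝ) (v : Site 2) :
    weightedLaplacian c (H₁ - H₂) v = weightedLaplacian c H₁ v - weightedLaplacian c H₂ v := by
  rw [sub_eq_add_neg, weightedLaplacian_add, weightedLaplacian_neg, ← sub_eq_add_neg]

/-- The weighted Laplacian is homogeneous. [folklore] -/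
theorem weightedLaplacian_const_mul (a : ℝ) (H : Site 2 → ℝ) (v : Site 2) :
    weightedLaplacian c (fun x => a * H x) v = a * weightedLaplacian c H v := by
  simp only [weightedLaplacian, Finset.mul_sum]
  refine Finset.sum_congr rfl fun k _ => ?_
  ring

/-- Constants are harmonic for every weight. [folklore] -/
theorem weightedLaplacian_const (a : ℝ) (v : Site 2) : weightedLaplacian c (fun _ => a) v = 0 := by
  simp [weightedLaplacian]

/-- Adding a constant does not change the weighted Laplacian. [folklore] -/
theorem weightedLaplacian_add_const (H : Site 2 → ℝ) (a : ℝ) (v : Site 2) :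
    weightedLaplacian c (fun x => H x + a) v = weightedLaplacian c H v := by
  have : (fun x => H x + a) = H + fun _ => a := rfl
  rw [this, weightedLaplacian_add, weightedLaplacian_const, add_zero]

/-! ### Sub/superharmonic functions -/

/-- `H` is **subharmonic** on `S` for the weights `c`: `Δ_c H ≥ 0` at every site of `S`.
[cite: DuminilCopinHonglerNolin2011, §3.1] -/
def IsWeightedSubharmonicOn (c : Site 2 → Fin 4 → ℝ) (H : Site 2 → ℝ) (S : Set (Site 2)) : Prop :=
  ∀ v ∈ S, 0 ≤ weightedLaplacian c H v

/-- `H` is **superharmonic** on `S` for the weights `c`: `Δ_c H ≤ 0` on `S`.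
[cite: DuminilCopinHonglerNolin2011, §3.1] -/
def IsWeightedSuperharmonicOn (c : Site 2 → Fin 4 → ℝ) (H : Site 2 → ℝ) (S : Set (Site 2)) : Prop :=
  ∀ v ∈ S, weightedLaplacian c H v ≤ 0

/-- `H` is superharmonic iff `-H` is subharmonic. [folklore] -/
theorem IsWeightedSuperharmonicOn.neg {H : Site 2 → ℝ} {S : Set (Site 2)}
    (h : IsWeightedSuperharmonicOn c H S) : IsWeightedSubharmonicOn c (-H) S := fun v hv => by
  rw [weightedLaplacian_neg]
  exact neg_nonneg.2 (h v hv)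

/-- A subharmonic minus a superharmonic function is subharmonic. [folklore] -/
theorem IsWeightedSubharmonicOn.sub {H₁ H₂ : Site 2 → ℝ} {S : Set (Site 2)}
    (h₁ : IsWeightedSubharmonicOn c H₁ S) (h₂ : IsWeightedSuperharmonicOn c H₂ S) :
    IsWeightedSubharmonicOn c (H₁ - H₂) S := fun v hv => by
  rw [weightedLaplacian_sub]
  linarith [h₁ v hv, h₂ v hv]

/-- Monotonicity in the set. [folklore] -/
theorem IsWeightedSubharmonicOn.mono {H : Site 2 → ℝ} {S T : Set (Site 2)} (h : IsWeightedSubharmonicOn c H S)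
    (hTS : T ⊆ S) : IsWeightedSubharmonicOn c H T := fun v hv => h v (hTS hv)

/-- Monotonicity in the set. [folklore] -/
theorem IsWeightedSuperharmonicOn.mono {H : Site 2 → ℝ} {S T : Set (Site 2)} (h : IsWeightedSuperharmonicOn c H S)
    (hTS : T ⊆ S) : IsWeightedSuperharmonicOn c H T := fun v hv => h v (hTS hv)

/-! ### The maximum principle -/

/-- **Mean value inequality at a maximum, positive weights.** If `Δ_c H (v) ≥ 0` with all four
weights at `v` positive, `H v = M` and the four neighbours are `≤ M`, then the four neighbours
equal `M`. [folklore] -/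
theorem eq_of_weightedLaplacian_nonneg {H : Site 2 → ℝ} {v : Site 2} {M : ℝ} (hc : ∀ k, 0 < c v k)
    (hΔ : 0 ≤ weightedLaplacian c H v) (hv : H v = M) (hle : ∀ k : Fin 4, H (v + cornerUnit k) ≤ M)
    (k : Fin 4) : H (v + cornerUnit k) = M := by
  have hnonpos : ∀ j ∈ (univ : Finset (Fin 4)), c v j * (H (v + cornerUnit j) - H v) ≤ 0 := fun j _ => by
    rw [hv]
    exact mul_nonpos_of_nonneg_of_nonpos (hc j).le (by linarith [hle j])
  have hsum : ∑ j : Fin 4, c v j * (H (v + cornerUnit j) - H v) = 0 :=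
    le_antisymm (Finset.sum_nonpos hnonpos) hΔ
  have h0 := (Finset.sum_eq_zero_iff_of_nonpos hnonpos).1 hsum k (mem_univ k)
  rcases mul_eq_zero.1 h0 with h | h
  · exact absurd h (hc k).ne'
  · linarith

/-- **The discrete maximum principle for weighted Laplacians.** Let `S ⊆ ℤ²` be finite, the
weights positive on `S`, and `H` subharmonic on `S`. If `H ≤ M` on the outer boundary of `S`, then
`H ≤ M` on `S`. (DCHN 2011, proof of Proposition 8: comparison through sub/superharmonicity for
the generator of the modified walk; Lawler–Limic 2010, §6.1.) [folklore] -/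
theorem IsWeightedSubharmonicOn.le_of_forall_boundary_le {H : Site 2 → ℝ} {S : Set (Site 2)}
    (hS : S.Finite) (hc : ∀ v ∈ S, ∀ k, 0 < c v k) (h : IsWeightedSubharmonicOn c H S) {M : ℝ}
    (hM : ∀ w ∈ latticeOuterBoundary S, H w ≤ M) : ∀ v ∈ S, H v ≤ M := by
  intro v₁ hv₁
  by_contra hlt
  push Not at hlt
  set T := S ∪ latticeOuterBoundary S with hT
  have hTfin : T.Finite := hS.union (latticeOuterBoundary_finite hS)
  obtain ⟨v₀, hv₀T, hmax⟩ := Set.exists_max_image T H hTfin ⟨v₁, Or.inl hv₁⟩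
  set M' := H v₀ with hM'
  have hMM' : M < M' := lt_of_lt_of_le hlt (hmax v₁ (Or.inl hv₁))
  have key : ∀ n : ℕ, (∀ m < n, v₀ + m • cornerUnit 0 ∈ S) →
      H (v₀ + n • cornerUnit 0) = M' ∧ v₀ + n • cornerUnit 0 ∈ T := by
    intro n
    induction n with
    | zero => intro; simp [hM', hv₀T]
    | succ n ih =>
      intro hn
      have hnS : v₀ + n • cornerUnit 0 ∈ S := hn n n.lt_succ_self
      have ih' := ih fun m hm => hn m (hm.trans n.lt_succ_self)
      have hstep : v₀ + (n + 1) • cornerUnit 0 = v₀ + n • cornerUnit 0 + cornerUnit 0 := by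
        rw [succ_nsmul, add_assoc]
      rw [hstep]
      refine ⟨eq_of_weightedLaplacian_nonneg (hc _ hnS) (h _ hnS) ih'.1 (fun k => hmax _ ?_) 0,
        add_cornerUnit_mem_union hnS 0⟩
      exact add_cornerUnit_mem_union hnS k
  have hex : ∃ n : ℕ, v₀ + n • cornerUnit 0 ∉ S := by
    by_contra hall
    push Not at hall
    refine hS.not_infinite (Set.infinite_of_injective_forall_mem (f := fun n : ℕ => v₀ + n • cornerUnit 0)
      (fun a b hab => ?_) hall)
    have h' := congrArg (fun x : Site 2 => x 0) hab
    simp only [add_nsmul_cornerUnit_zero_apply, add_right_inj, Nat.cast_inj] at h'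
    exact h'
  classical
  let n := Nat.find hex
  have hn : v₀ + n • cornerUnit 0 ∉ S := Nat.find_spec hex
  have hlt' : ∀ m < n, v₀ + m • cornerUnit 0 ∈ S := fun m hm => by
    have := Nat.find_min hex hm
    simpa using this
  obtain ⟨hHM', hnT⟩ := key n hlt'
  have hbdry : v₀ + n • cornerUnit 0 ∈ latticeOuterBoundary S := hnT.resolve_left hn
  have := hM _ hbdry
  linarith

/-- **The discrete minimum principle** for weighted-superharmonic functions on a finite set. [folklore] -/
theorem IsWeightedSuperharmonicOn.ge_of_forall_boundary_ge {H : Site 2 → ℝ} {S : Set (Site 2)}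
    (hS : S.Finite) (hc : ∀ v ∈ S, ∀ k, 0 < c v k) (h : IsWeightedSuperharmonicOn c H S) {M : ℝ}
    (hM : ∀ w ∈ latticeOuterBoundary S, M ≤ H w) : ∀ v ∈ S, M ≤ H v := by
  intro v hv
  have := h.neg.le_of_forall_boundary_le hS hc (M := -M) (fun w hw => by simpa using hM w hw) v hv
  simpa using this

/-- **Comparison principle for weighted Laplacians**: on a finite set with positive weights, if
`H₁` is subharmonic, `H₂` is superharmonic and `H₁ ≤ H₂ + a` on the outer boundary, then
`H₁ ≤ H₂ + a` inside — the form in which DCHN's Proposition 8 bounds the discrete primitive of the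
observable by the harmonic measures of the modified walks ("since it has the same boundary
values"). [cite: DuminilCopinHonglerNolin2011, §3.1, proof of Proposition 8] -/
theorem weighted_le_of_sub_super_of_boundary {H₁ H₂ : Site 2 → ℝ} {S : Set (Site 2)} (hS : S.Finite)
    (hc : ∀ v ∈ S, ∀ k, 0 < c v k) (h₁ : IsWeightedSubharmonicOn c H₁ S) (h₂ : IsWeightedSuperharmonicOn c H₂ S)
    {a : ℝ} (hb : ∀ w ∈ latticeOuterBoundary S, H₁ w ≤ H₂ w + a) : ∀ v ∈ S, H₁ v ≤ H₂ v + a := by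
  intro v hv
  have key := (h₁.sub h₂).le_of_forall_boundary_le hS hc (M := a)
    (fun w hw => by rw [Pi.sub_apply, sub_le_iff_le_add']; exact hb w hw) v hv
  rw [Pi.sub_apply, sub_le_iff_le_add'] at key
  exact key

/-- **Supersolutions dominate subsolutions with smaller boundary data** (`a = 0`). [folklore] -/
theorem weighted_le_of_sub_super {H₁ H₂ : Site 2 → ℝ} {S : Set (Site 2)} (hS : S.Finite)
    (hc : ∀ v ∈ S, ∀ k, 0 < c v k) (h₁ : IsWeightedSubharmonicOn c H₁ S) (h₂ : IsWeightedSuperharmonicOn c H₂ S)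
    (hb : ∀ w ∈ latticeOuterBoundary S, H₁ w ≤ H₂ w) : ∀ v ∈ S, H₁ v ≤ H₂ v := by
  intro v hv
  have := weighted_le_of_sub_super_of_boundary hS hc h₁ h₂ (a := 0) (fun w hw => by rw [add_zero]; exact hb w hw) v hv
  rwa [add_zero] at this

/-- A nonnegative superharmonic function with positive weights on a finite set, nonnegative on the
outer boundary, is nonnegative (minimum principle with `M = 0`). [folklore] -/
theorem IsWeightedSuperharmonicOn.nonneg {H : Site 2 → ℝ} {S : Set (Site 2)} (hS : S.Finite)
    (hc : ∀ v ∈ S, ∀ k, 0 < c v k) (h : IsWeightedSuperharmonicOn c H S)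
    (hM : ∀ w ∈ latticeOuterBoundary S, 0 ≤ H w) : ∀ v ∈ S, 0 ≤ H v :=
  h.ge_of_forall_boundary_ge hS hc hM

end Literature.Probability.LatticeModels
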